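import Literature.AlgebraicTopology.SingularHomology.LocalHomologyMayerVietorisCriteria
import Literature.AlgebraicTopology.SingularHomology.LocalHomologyOfSetTransfer
import Literature.AlgebraicTopology.SingularHomology.LocalHomologyCharts
import Literature.AlgebraicTopology.SingularHomology.LocalHomologyVanishing
import Mathlib.Analysis.InnerProductSpace.PiL2
import HarnessLib

/-!
# Local homology along a sphere with a product neighbourhood vanishes below the codimension

Topic `Literature/AlgebraicTopology/SingularHomology` (fact seat `provefact-…` of
`Literature.Topology.FourManifolds.HomotopySphere.exists_highlyConnected_of_mem_signatureSet`,
Kosinski's X.1.1/X.2.2: the homology of a manifold below the middle dimension is not changed by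
removing a sphere of high codimension — "the effect of surgery on homology").

Let `X` be a Hausdorff space and `ψ : S × ℝᶜ → X` an open embedding, where `S` is a `k`-sphere;
write `Σ = ψ(S × 0)` for its core.  We PROVE (`isZero_localHomologyOfSet_sphereCore`):

  **`H_i(X | Σ; M) = H_i(X, X ∖ Σ; M) = 0` for all `i < c`.**

Consequently (long exact sequence of the pair `(X, X ∖ Σ)`) the inclusion `X ∖ Σ ↪ X` induces
isomorphisms `H_i(X ∖ Σ) ≅ H_i(X)` for `i + 1 < c` and an epimorphism for `i + 1 = c`
(`isIso_map_subsetIncl_compl_sphereCore`, `epi_map_subsetIncl_compl_sphereCore`).  This is the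
homological content of A. Kosinski, *Differential Manifolds* (1993), X.1, proof of Prop. (1.1)
("`H_i(M ∖ S) → H_i M` is an isomorphism for `i < m - k`", there via general position and
transversality; equivalently Hatcher 2002, Prop. 2B.1-style Alexander duality), obtained here
PD-free and Künneth-free from the tree's local homology tool kit:

* the relative Mayer–Vietoris criterion `isZero_localHomologyOfSet_union` (Hatcher §2.2 p. 152;
  `LocalHomologyMayerVietorisCriteria.lean`),
* transfer of local homology along open embeddings across universes
  (`localHomologyOfSet.isZero_iff_of_isOpenEmbedding`, `LocalHomologyOfSetTransfer.lean`),
* `H_i(ℝᵈ | C) ≅ H_i(ℝᵈ | x) = 0` for compact convex `C ∋ x` and `i ≠ d`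
  (`isIso_restrictToPoint_of_convex_chart`, `LocalHomologyCharts.lean`;
  `isZero_localHomology_rvec`, `LocalHomologyVanishing.lean`).

## The induction (cube model of the sphere)

The sphere is taken in the **sup-norm model** `Q_j = {x : ℝʲ⁺¹ | ‖x‖_∞ = 1}` (the boundary of the
cube, `Metric.sphere 0 1` in `Fin (j + 1) → ℝ`), in which hemispheres are flat: by induction on `j`
(for all fibre dimensions `c` at once), `H_i(X | ψ(Q_j × 0)) = 0` for `i < c`.

* `j = 0`: `Q₀ = {±1}`, and `H_i(X | pt) ≅ H_i(ℝᶜ | 0) = 0` for `i ≠ c` along `v ↦ ψ(±1, v)`.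
* `j + 1`: `Q_{j+1} = A ∪ B` with `A = {x_last ≥ 0}`, `B = {x_last ≤ 0}`,
  `A ∩ B = {x_last = 0} ≅ Q_j`.  The **central projection from the centre of the bottom face**,
  `P x = (2 xᵢ / (x_last + 1))ᵢ`, is a homeomorphism of `Q_{j+1} ∖ {x_last = -1}` onto `ℝʲ⁺¹`
  (inverse `y ↦ (y / m, 2 / m - 1)`, `m = max 1 ‖y‖_∞`) carrying `A` onto the cube `[-2, 2]ʲ⁺¹`
  (`cubeProjFun`/`cubeProjInv`/`cubeProjHomeomorph`, `image_cubeProjInv_closedBall`), so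
  `H_i(X | ψ(A × 0)) ≅ H_i(ℝʲ⁺¹⁺ᶜ | convex) = 0`
  for `i ≠ j + 1 + c`; the same for `B` by the reflection `x_last ↦ -x_last`; and
  `ψ((A ∩ B) × 0)` is the core of the open embedding `Q_j × ℝᶜ⁺¹ → X`,
  `(y, w) ↦ ψ((y, τ w₀), w₁…)` (`τ : ℝ ≅ (-1, 1)`), of fibre dimension `c + 1`, whose local
  homology vanishes for `i < c + 1` by induction — exactly the input `H_{i+1}(X | A ∩ B) = 0`,
  `i < c`, of the Mayer–Vietoris criterion.

The Euclidean unit sphere `𝕊 k ⊆ EuclideanSpace ℝ (Fin (k + 1))` is radially homeomorphic to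
`Q_k` (`sphereSupHomeomorph`), which gives the statement for tubes `𝕊 k × ℝᶜ → X` as they occur
in the tree (`Literature.Topology.FourManifolds.FramedSphereFamily`).

Everything is proved; no named facts.  Definitions (with bodies): the coordinate maps
`cubeProjFun`, `cubeProjInv`, `cubeProjHomeomorph`, `negLast`, `equatorEmb`, `realToIoo`,
`sphereSupHomeomorph` of the cube model.

## References

* A. Kosinski, *Differential Manifolds* (1993), X.1, Prop. (1.1) and its proof. [Kosinski1993]
* A. Hatcher, *Algebraic Topology*, CUP 2002, §2.2 p. 152 (relative Mayer–Vietoris), §3.3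
  pp. 231–236 (local homology, proof of Lemma 3.27). [HatcherAT2002]
-/

noncomputable section

open CategoryTheory Limits Set Function Metric Topology

universe u v

namespace Literature.AlgebraicTopology.SingularHomology

variable (R : Type v) [CommRing R] (M : Type v) [AddCommGroup M] [Module R M]

/-! ### Local homology of `ℝᵈ` (and of products `ℝᵃ × ℝᵇ`) at compact convex sets -/

section Convex

/-- **`H_i(ℝᵈ | C; M) = 0` for `i ≠ d` and `C ⊆ ℝᵈ` nonempty compact convex** (Hatcher 2002,
proof of Lemma 3.27, steps (2)–(3): `H_i(ℝᵈ | C) ≅ H_i(ℝᵈ | x)` for `x ∈ C`, and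
`H_i(ℝᵈ | x) = 0` for `i ≠ d`). [cite: HatcherAT2002, Lemma 3.27] -/
theorem isZero_localHomologyOfSet_rvec_of_convex {d : ℕ} {C : Set (RVec d)} (hCc : Convex ℝ C)
    (hCK : IsCompact C) (hCn : C.Nonempty) {i : ℕ} (hi : i ≠ d) :
    IsZero (localHomologyOfSet R M (RVec d) C i) := by
  obtain ⟨x, hx⟩ := hCn
  obtain ⟨r, hr, hCr⟩ : ∃ r, 0 < r ∧ C ⊆ closedBall x r := by
    obtain ⟨r, hr⟩ := hCK.isBounded.subset_closedBall x
    exact ⟨max r 1, by positivity, hr.trans (closedBall_subset_closedBall (le_max_left _ _))⟩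
  have hK : C = (OpenPartialHomeomorph.refl (RVec d)).source ∩
      (OpenPartialHomeomorph.refl (RVec d)) ⁻¹' C := by simp
  haveI := isIso_restrictToPoint_of_convex_chart R M (OpenPartialHomeomorph.refl (RVec d)) hr
    (by simp) hCc hCr hK hx i
  exact IsZero.of_iso (isZero_localHomology_rvec R M x hi) (asIso (restrictToPoint R M hx i))

/-- **`H_i(ℝᵃ × ℝᵇ | C; M) = 0` for `i ≠ a + b` and `C` nonempty compact convex**: transport of
`isZero_localHomologyOfSet_rvec_of_convex` along a linear homeomorphism `ℝᵃ × ℝᵇ ≅ ℝᵃ⁺ᵇ` (an open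
embedding; `localHomologyOfSet.isZero_iff_of_isOpenEmbedding`). [cite: HatcherAT2002, Lemma 3.27] -/
theorem isZero_localHomologyOfSet_rvec_prod_of_convex {a b : ℕ} {C : Set (RVec a × RVec b)}
    (hCc : Convex ℝ C) (hCK : IsCompact C) (hCn : C.Nonempty) {i : ℕ} (hi : i ≠ a + b) :
    IsZero (localHomologyOfSet R M (RVec a × RVec b) C i) := by
  let L : (RVec a × RVec b) ≃L[ℝ] RVec (a + b) :=
    ContinuousLinearEquiv.ofFinrankEq (by simp)
  have hL : IsOpenEmbedding L := L.toHomeomorph.isOpenEmbedding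
  have hLC : IsClosed (L '' C) := (hCK.image L.continuous).isClosed
  rw [localHomologyOfSet.isZero_iff_of_isOpenEmbedding R M hL hLC]
  exact isZero_localHomologyOfSet_rvec_of_convex R M (hCc.is_linear_image L.isLinear)
    (hCK.image L.continuous) (hCn.image _) hi

end Convex

/-! ### The cube model `Q_j = {‖x‖_∞ = 1}` of the `j`-sphere and its flat hemispheres -/

section CubeModel

variable {j : ℕ}

/-- The sup-norm unit sphere `Q_j ⊆ ℝʲ⁺¹` (boundary of the cube `[-1, 1]ʲ⁺¹`), the cube model of
the `j`-sphere. [folklore] -/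
abbrev CubeSphere (j : ℕ) : Type := ↥(sphere (0 : RVec (j + 1)) 1)

/-- Coordinates of a point of the cube sphere are bounded by `1`. [folklore] -/
theorem CubeSphere.abs_apply_le (x : CubeSphere j) (i : Fin (j + 1)) : |x.1 i| ≤ 1 := by
  have h : ‖x.1‖ = 1 := mem_sphere_zero_iff_norm.1 x.2
  have := norm_le_pi_norm x.1 i
  rw [h, Real.norm_eq_abs] at this
  exact this

/-- A point of the cube sphere has a coordinate of absolute value `1`. [folklore] -/
theorem CubeSphere.exists_abs_apply_eq_one (x : CubeSphere j) : ∃ i, |x.1 i| = 1 := by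
  have h : ‖x.1‖ = 1 := mem_sphere_zero_iff_norm.1 x.2
  haveI : Nonempty (Fin (j + 1)) := ⟨0⟩
  obtain ⟨i, -, hi⟩ := Finset.exists_max_image Finset.univ (fun i ↦ |x.1 i|) Finset.univ_nonempty
  refine ⟨i, le_antisymm (x.abs_apply_le i) ?_⟩
  have h2 : ‖x.1‖ ≤ |x.1 i| := (pi_norm_le_iff_of_nonneg (abs_nonneg _)).2 fun k ↦ by
    rw [Real.norm_eq_abs]; exact hi k (Finset.mem_univ k)
  rwa [h] at h2

/-- A vector all of whose coordinates are bounded by `1` in absolute value and one of which has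
absolute value `1` lies on the cube sphere. [folklore] -/
theorem mem_cubeSphere_of_abs_le {y : RVec (j + 1)} (h : ∀ i, |y i| ≤ 1) {i₀ : Fin (j + 1)}
    (h₀ : |y i₀| = 1) : y ∈ sphere (0 : RVec (j + 1)) 1 := by
  rw [mem_sphere_zero_iff_norm]
  refine le_antisymm ((pi_norm_le_iff_of_nonneg zero_le_one).2 fun i ↦ ?_) ?_
  · rw [Real.norm_eq_abs]; exact h i
  · have := norm_le_pi_norm y i₀
    rw [Real.norm_eq_abs, h₀] at this
    exact this

variable (j)

/-- The **upper half** `A = {x ∈ Q_{j+1} | 0 ≤ x_last}` of the cube sphere (a closed `(j+1)`-cell,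
the union of the top face and the upper halves of the side faces). [folklore] -/
def upperHalf : Set (CubeSphere (j + 1)) := {x | 0 ≤ x.1 (Fin.last (j + 1))}

/-- The **lower half** `B = {x ∈ Q_{j+1} | x_last ≤ 0}` of the cube sphere. [folklore] -/
def lowerHalf : Set (CubeSphere (j + 1)) := {x | x.1 (Fin.last (j + 1)) ≤ 0}

/-- The **equator** `{x ∈ Q_{j+1} | x_last = 0}` of the cube sphere. [folklore] -/
def equator : Set (CubeSphere (j + 1)) := {x | x.1 (Fin.last (j + 1)) = 0}

/-- The domain `{x ∈ Q_{j+1} | -1 < x_last}` of the central projection (the cube sphere minus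
its closed bottom face). [folklore] -/
def projDom : Set (CubeSphere (j + 1)) := {x | -1 < x.1 (Fin.last (j + 1))}

variable {j}

/-- The two halves cover the cube sphere. [folklore] -/
theorem upperHalf_union_lowerHalf : upperHalf j ∪ lowerHalf j = univ :=
  eq_univ_of_forall fun x ↦ (le_total 0 (x.1 (Fin.last (j + 1)))).imp id id

/-- The two halves meet in the equator. [folklore] -/
theorem upperHalf_inter_lowerHalf : upperHalf j ∩ lowerHalf j = equator j := by
  ext x
  simp only [upperHalf, lowerHalf, equator, mem_inter_iff, mem_setOf_eq]
  constructor
  · rintro ⟨h1, h2⟩; exact le_antisymm h2 h1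
  · intro h; exact ⟨h.ge, h.le⟩

/-- The upper half lies in the domain of the central projection. [folklore] -/
theorem upperHalf_subset_projDom : upperHalf j ⊆ projDom j := fun x hx ↦
  show -1 < x.1 (Fin.last (j + 1)) from lt_of_lt_of_le (by norm_num) hx

/-- The domain of the central projection is open. [folklore] -/
theorem isOpen_projDom : IsOpen (projDom j) :=
  isOpen_lt continuous_const ((continuous_apply _).comp continuous_subtype_val)

/-- The upper half is closed. [folklore] -/
theorem isClosed_upperHalf : IsClosed (upperHalf j) :=
  isClosed_le continuous_const ((continuous_apply _).comp continuous_subtype_val)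

/-- The lower half is closed. [folklore] -/
theorem isClosed_lowerHalf : IsClosed (lowerHalf j) :=
  isClosed_le ((continuous_apply _).comp continuous_subtype_val) continuous_const

/-! #### The central projection from the centre of the bottom face -/

/-- The **central projection** `P x = (2 xᵢ / (x_last + 1))ᵢ` from the centre `(0, …, 0, -1)` of the
bottom face onto the hyperplane of the top face (as a map to `ℝʲ⁺¹`; meaningful for
`-1 < x_last`). [folklore] -/
def cubeProjFun (x : CubeSphere (j + 1)) : RVec (j + 1) :=
  fun i ↦ 2 * x.1 (Fin.castSucc i) / (x.1 (Fin.last (j + 1)) + 1)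

/-- The scaling factor `m y = max 1 ‖y‖_∞ ≥ 1` of the inverse central projection. [folklore] -/
def projScale (y : RVec (j + 1)) : ℝ := max 1 ‖y‖

/-- `1 ≤ m y`. [folklore] -/
theorem one_le_projScale (y : RVec (j + 1)) : 1 ≤ projScale y := le_max_left _ _

/-- `0 < m y`. [folklore] -/
theorem projScale_pos (y : RVec (j + 1)) : 0 < projScale y :=
  lt_of_lt_of_le one_pos (one_le_projScale y)

/-- `‖y‖_∞ ≤ m y`. [folklore] -/
theorem norm_le_projScale (y : RVec (j + 1)) : ‖y‖ ≤ projScale y := le_max_right _ _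

/-- `m` is continuous. [folklore] -/
theorem continuous_projScale : Continuous (projScale : RVec (j + 1) → ℝ) :=
  continuous_const.max continuous_norm

/-- The vector `(y / m, 2 / m - 1) ∈ ℝʲ⁺²` of the inverse central projection. [folklore] -/
def cubeProjInvVec (y : RVec (j + 1)) : RVec (j + 2) :=
  Fin.snoc (fun i ↦ y i / projScale y) (2 / projScale y - 1)

/-- The first coordinates of `cubeProjInvVec y` are `yᵢ / m`. [folklore] -/
@[simp] theorem cubeProjInvVec_castSucc (y : RVec (j + 1)) (i : Fin (j + 1)) :
    cubeProjInvVec y (Fin.castSucc i) = y i / projScale y := by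
  simp [cubeProjInvVec]

/-- The last coordinate of `cubeProjInvVec y` is `2 / m - 1`. [folklore] -/
@[simp] theorem cubeProjInvVec_last (y : RVec (j + 1)) :
    cubeProjInvVec y (Fin.last (j + 1)) = 2 / projScale y - 1 := by
  simp [cubeProjInvVec]

/-- `-1 < 2 / m - 1`: the inverse projection misses the bottom face. [folklore] -/
theorem neg_one_lt_cubeProjInvVec_last (y : RVec (j + 1)) :
    -1 < cubeProjInvVec y (Fin.last (j + 1)) := by
  rw [cubeProjInvVec_last]
  have := div_pos (two_pos : (0 : ℝ) < 2) (projScale_pos y)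
  linarith

/-- `2 / m - 1 ≤ 1`. [folklore] -/
theorem cubeProjInvVec_last_le_one (y : RVec (j + 1)) :
    cubeProjInvVec y (Fin.last (j + 1)) ≤ 1 := by
  rw [cubeProjInvVec_last]
  have h1 := one_le_projScale y
  have : 2 / projScale y ≤ 2 := by
    rw [div_le_iff₀ (projScale_pos y)]; linarith
  linarith

/-- `cubeProjInvVec y` lies on the cube sphere. [folklore] -/
theorem cubeProjInvVec_mem (y : RVec (j + 1)) : cubeProjInvVec y ∈ sphere (0 : RVec (j + 2)) 1 := by
  have hm := projScale_pos y
  have hbound : ∀ i, |cubeProjInvVec y i| ≤ 1 := by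
    intro i
    refine Fin.lastCases ?_ (fun i ↦ ?_) i
    · rw [abs_le]
      exact ⟨(neg_one_lt_cubeProjInvVec_last y).le, cubeProjInvVec_last_le_one y⟩
    · rw [cubeProjInvVec_castSucc, abs_div, abs_of_pos hm, div_le_one hm]
      have := norm_le_pi_norm y i
      rw [Real.norm_eq_abs] at this
      exact this.trans (norm_le_projScale y)
  by_cases hy : 1 ≤ ‖y‖
  · -- `m = ‖y‖` and a coordinate of `y` attains the sup norm
    have hm' : projScale y = ‖y‖ := max_eq_right hy
    haveI : Nonempty (Fin (j + 1)) := ⟨0⟩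
    obtain ⟨i, -, hi⟩ := Finset.exists_max_image Finset.univ (fun i ↦ |y i|) Finset.univ_nonempty
    have hyi : |y i| = ‖y‖ := by
      refine le_antisymm ?_ ?_
      · have := norm_le_pi_norm y i
        rwa [Real.norm_eq_abs] at this
      · refine (pi_norm_le_iff_of_nonneg (abs_nonneg _)).2 fun k ↦ ?_
        rw [Real.norm_eq_abs]
        exact hi k (Finset.mem_univ k)
    refine mem_cubeSphere_of_abs_le hbound (i₀ := Fin.castSucc i) ?_
    rw [cubeProjInvVec_castSucc, abs_div, abs_of_pos hm, hyi, hm', div_self]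
    exact (lt_of_lt_of_le one_pos hy).ne'
  · -- `m = 1` and the last coordinate is `1`
    have hm' : projScale y = 1 := max_eq_left (not_le.1 hy).le
    refine mem_cubeSphere_of_abs_le hbound (i₀ := Fin.last (j + 1)) ?_
    rw [cubeProjInvVec_last, hm']
    norm_num

/-- The **inverse central projection** `ℝʲ⁺¹ → Q_{j+1}`, `y ↦ (y / m, 2 / m - 1)`. [folklore] -/
def cubeProjInv (y : RVec (j + 1)) : CubeSphere (j + 1) := ⟨cubeProjInvVec y, cubeProjInvVec_mem y⟩

/-- The underlying vector of `cubeProjInv y`. [folklore] -/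
@[simp] theorem cubeProjInv_val (y : RVec (j + 1)) : (cubeProjInv y).1 = cubeProjInvVec y := rfl

/-- `cubeProjInv` lands in the domain of the central projection. [folklore] -/
theorem cubeProjInv_mem_projDom (y : RVec (j + 1)) : cubeProjInv y ∈ projDom j :=
  neg_one_lt_cubeProjInvVec_last y

/-- `cubeProjInv` is continuous. [folklore] -/
theorem continuous_cubeProjInv : Continuous (cubeProjInv : RVec (j + 1) → CubeSphere (j + 1)) := by
  refine Continuous.subtype_mk ?_ _
  unfold cubeProjInvVec
  refine continuous_pi fun i ↦ ?_
  refine Fin.lastCases ?_ (fun i ↦ ?_) i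
  · simp only [Fin.snoc_last]
    exact (continuous_const.div continuous_projScale fun y ↦ (projScale_pos y).ne').sub
      continuous_const
  · simp only [Fin.snoc_castSucc]
    exact (continuous_apply i).div continuous_projScale fun y ↦ (projScale_pos y).ne'

/-- `cubeProjFun` is continuous on the domain `-1 < x_last`. [folklore] -/
theorem continuousOn_cubeProjFun : ContinuousOn (cubeProjFun : CubeSphere (j + 1) → RVec (j + 1))
    (projDom j) := by
  refine continuousOn_pi.2 fun i ↦ ?_
  have h1 : Continuous fun x : CubeSphere (j + 1) ↦ 2 * x.1 (Fin.castSucc i) :=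
    continuous_const.mul ((continuous_apply _).comp continuous_subtype_val)
  have h2 : Continuous fun x : CubeSphere (j + 1) ↦ x.1 (Fin.last (j + 1)) + 1 :=
    ((continuous_apply _).comp continuous_subtype_val).add continuous_const
  exact h1.continuousOn.div h2.continuousOn fun x hx ↦ by
    have : -1 < x.1 (Fin.last (j + 1)) := hx
    linarith

/-- `P (P⁻¹ y) = y`. [folklore] -/
theorem cubeProjFun_cubeProjInv (y : RVec (j + 1)) : cubeProjFun (cubeProjInv y) = y := by
  funext i
  have hm := projScale_pos y
  simp only [cubeProjFun, cubeProjInv_val, cubeProjInvVec_castSucc, cubeProjInvVec_last]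
  field_simp
  ring

/-- On the domain, the scaling factor of `P x` is `2 / (x_last + 1)`. [folklore] -/
theorem projScale_cubeProjFun {x : CubeSphere (j + 1)} (hx : x ∈ projDom j) :
    projScale (cubeProjFun x) = 2 / (x.1 (Fin.last (j + 1)) + 1) := by
  have hlast : -1 < x.1 (Fin.last (j + 1)) := hx
  have hpos : 0 < x.1 (Fin.last (j + 1)) + 1 := by linarith
  have hle1 := x.abs_apply_le (Fin.last (j + 1))
  -- the sup norm of `P x` is `2 s / (x_last + 1)` with `s` the sup of the first coordinates
  have hnorm : ‖cubeProjFun x‖ = 2 / (x.1 (Fin.last (j + 1)) + 1) *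
      ‖fun i : Fin (j + 1) ↦ x.1 (Fin.castSucc i)‖ := by
    have : cubeProjFun x = (2 / (x.1 (Fin.last (j + 1)) + 1)) •
        fun i : Fin (j + 1) ↦ x.1 (Fin.castSucc i) := by
      funext i; simp only [cubeProjFun, Pi.smul_apply, smul_eq_mul]; ring
    rw [this, norm_smul, Real.norm_eq_abs, abs_of_pos (div_pos two_pos hpos)]
  set s := ‖fun i : Fin (j + 1) ↦ x.1 (Fin.castSucc i)‖ with hs
  have hs1 : s ≤ 1 := by
    refine (pi_norm_le_iff_of_nonneg zero_le_one).2 fun i ↦ ?_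
    rw [Real.norm_eq_abs]; exact x.abs_apply_le _
  rw [projScale, hnorm]
  -- either a first coordinate has absolute value `1`, or the last one does (and then it is `+1`)
  obtain ⟨i, hi⟩ := x.exists_abs_apply_eq_one
  revert hi
  refine Fin.lastCases (fun hi ↦ ?_) (fun i hi ↦ ?_) i
  · have h1 : x.1 (Fin.last (j + 1)) = 1 := by
      rcases abs_eq (zero_le_one) |>.1 hi with h | h
      · exact h
      · linarith
    rw [h1, show (2 : ℝ) / (1 + 1) = 1 by norm_num, one_mul]
    exact max_eq_left hs1
  · have hs1' : s = 1 := by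
      refine le_antisymm hs1 ?_
      have := norm_le_pi_norm (fun i : Fin (j + 1) ↦ x.1 (Fin.castSucc i)) i
      rw [Real.norm_eq_abs, hi] at this
      exact this
    rw [hs1', mul_one]
    refine max_eq_right ?_
    rw [le_div_iff₀ hpos]
    have := (abs_le.1 hle1).2
    linarith

/-- `P⁻¹ (P x) = x` on the domain `-1 < x_last`. [folklore] -/
theorem cubeProjInv_cubeProjFun {x : CubeSphere (j + 1)} (hx : x ∈ projDom j) :
    cubeProjInv (cubeProjFun x) = x := by
  have hlast : -1 < x.1 (Fin.last (j + 1)) := hx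
  have hpos : 0 < x.1 (Fin.last (j + 1)) + 1 := by linarith
  have hm := projScale_cubeProjFun hx
  apply Subtype.ext
  funext i
  refine Fin.lastCases ?_ (fun i ↦ ?_) i
  · rw [cubeProjInv_val, cubeProjInvVec_last, hm]
    field_simp
    ring
  · rw [cubeProjInv_val, cubeProjInvVec_castSucc, hm]
    simp only [cubeProjFun]
    field_simp

/-- **The central projection as a homeomorphism `ℝʲ⁺¹ ≃ₜ {x ∈ Q_{j+1} | -1 < x_last}`** (its
inverse, to be precise). [folklore] -/
def cubeProjHomeomorph : RVec (j + 1) ≃ₜ ↥(projDom j) where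
  toFun y := ⟨cubeProjInv y, cubeProjInv_mem_projDom y⟩
  invFun x := cubeProjFun x.1
  left_inv y := cubeProjFun_cubeProjInv y
  right_inv x := Subtype.ext (cubeProjInv_cubeProjFun x.2)
  continuous_toFun := continuous_cubeProjInv.subtype_mk _
  continuous_invFun := continuousOn_cubeProjFun.comp_continuous continuous_subtype_val
    fun x ↦ x.2

/-- `cubeProjInv : ℝʲ⁺¹ → Q_{j+1}` is an open embedding (a homeomorphism onto the open subset
`-1 < x_last`). [folklore] -/
theorem isOpenEmbedding_cubeProjInv :
    IsOpenEmbedding (cubeProjInv : RVec (j + 1) → CubeSphere (j + 1)) :=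
  (isOpen_projDom.isOpenEmbedding_subtypeVal).comp cubeProjHomeomorph.isOpenEmbedding

/-- **The upper half is the image of the cube `[-2, 2]ʲ⁺¹`** (the sup-norm closed ball of radius
`2`) under the inverse central projection. [folklore] -/
theorem image_cubeProjInv_closedBall :
    cubeProjInv '' closedBall (0 : RVec (j + 1)) 2 = upperHalf j := by
  ext x
  constructor
  · rintro ⟨y, hy, rfl⟩
    rw [mem_closedBall, dist_zero_right] at hy
    show 0 ≤ (cubeProjInv y).1 (Fin.last (j + 1))
    rw [cubeProjInv_val, cubeProjInvVec_last, sub_nonneg, le_div_iff₀ (projScale_pos y)]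
    simp only [projScale, one_mul, max_le_iff]
    exact ⟨by norm_num, hy⟩
  · intro hx
    have hx' : x ∈ projDom j := upperHalf_subset_projDom hx
    refine ⟨cubeProjFun x, ?_, cubeProjInv_cubeProjFun hx'⟩
    rw [mem_closedBall, dist_zero_right]
    have hm := projScale_cubeProjFun hx'
    have h0 : 0 ≤ x.1 (Fin.last (j + 1)) := hx
    have hpos : 0 < x.1 (Fin.last (j + 1)) + 1 := by linarith
    calc ‖cubeProjFun x‖ ≤ projScale (cubeProjFun x) := norm_le_projScale _
      _ = 2 / (x.1 (Fin.last (j + 1)) + 1) := hm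
      _ ≤ 2 := by rw [div_le_iff₀ hpos]; linarith

/-! #### The reflection in the last coordinate -/

/-- Negating the last coordinate preserves the cube sphere. [folklore] -/
theorem negLastVec_mem (x : CubeSphere (j + 1)) :
    (Fin.snoc (fun i : Fin (j + 1) ↦ x.1 (Fin.castSucc i)) (-x.1 (Fin.last (j + 1))) :
      RVec (j + 2)) ∈ sphere (0 : RVec (j + 2)) 1 := by
  have hbound : ∀ i, |(Fin.snoc (fun i : Fin (j + 1) ↦ x.1 (Fin.castSucc i))
      (-x.1 (Fin.last (j + 1))) : RVec (j + 2)) i| ≤ 1 := by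
    intro i
    refine Fin.lastCases ?_ (fun i ↦ ?_) i
    · simp only [Fin.snoc_last, abs_neg]; exact x.abs_apply_le _
    · simp only [Fin.snoc_castSucc]; exact x.abs_apply_le _
  obtain ⟨i, hi⟩ := x.exists_abs_apply_eq_one
  revert hi
  refine Fin.lastCases (fun hi ↦ ?_) (fun i hi ↦ ?_) i
  · exact mem_cubeSphere_of_abs_le hbound (i₀ := Fin.last (j + 1)) (by simpa using hi)
  · exact mem_cubeSphere_of_abs_le hbound (i₀ := Fin.castSucc i) (by simpa using hi)

/-- **The reflection `x_last ↦ -x_last`** of the cube sphere. [folklore] -/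
def negLast : CubeSphere (j + 1) ≃ₜ CubeSphere (j + 1) where
  toFun x := ⟨_, negLastVec_mem x⟩
  invFun x := ⟨_, negLastVec_mem x⟩
  left_inv x := by
    apply Subtype.ext; funext i
    refine Fin.lastCases ?_ (fun i ↦ ?_) i <;> simp
  right_inv x := by
    apply Subtype.ext; funext i
    refine Fin.lastCases ?_ (fun i ↦ ?_) i <;> simp
  continuous_toFun := by
    refine Continuous.subtype_mk (continuous_pi fun i ↦ ?_) _
    refine Fin.lastCases ?_ (fun i ↦ ?_) i
    · simp only [Fin.snoc_last]
      exact ((continuous_apply _).comp continuous_subtype_val).neg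
    · simp only [Fin.snoc_castSucc]
      exact (continuous_apply _).comp continuous_subtype_val
  continuous_invFun := by
    refine Continuous.subtype_mk (continuous_pi fun i ↦ ?_) _
    refine Fin.lastCases ?_ (fun i ↦ ?_) i
    · simp only [Fin.snoc_last]
      exact ((continuous_apply _).comp continuous_subtype_val).neg
    · simp only [Fin.snoc_castSucc]
      exact (continuous_apply _).comp continuous_subtype_val

/-- The last coordinate of `negLast x` is `-x_last`. [folklore] -/
@[simp] theorem negLast_val_last (x : CubeSphere (j + 1)) :
    (negLast x).1 (Fin.last (j + 1)) = -x.1 (Fin.last (j + 1)) := by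
  simp [negLast]

/-- The reflection maps the upper half onto the lower half. [folklore] -/
theorem image_negLast_upperHalf : negLast '' upperHalf j = lowerHalf j := by
  ext x
  constructor
  · rintro ⟨y, hy, rfl⟩
    show (negLast y).1 (Fin.last (j + 1)) ≤ 0
    rw [negLast_val_last, neg_nonpos]; exact hy
  · intro hx
    refine ⟨negLast.symm x, ?_, negLast.apply_symm_apply x⟩
    show 0 ≤ (negLast.symm x).1 (Fin.last (j + 1))
    have : (negLast.symm x).1 (Fin.last (j + 1)) = -x.1 (Fin.last (j + 1)) := by
      simp [negLast]
    rw [this, neg_nonneg]; exact hx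

/-! #### The equator as the core of a tube with one more fibre dimension -/

/-- The homeomorphism `τ : ℝ ≃ₜ (-1, 1)`, `t ↦ t / (1 + |t|)` (inverse `s ↦ s / (1 - |s|)`).
[folklore] -/
def realToIoo : ℝ ≃ₜ Ioo (-1 : ℝ) 1 where
  toFun t := ⟨t / (1 + |t|), by
    have h : 0 < 1 + |t| := by have := abs_nonneg t; linarith
    rw [mem_Ioo, lt_div_iff₀ h, div_lt_iff₀ h]
    constructor <;> cases abs_cases t <;> linarith⟩
  invFun s := s.1 / (1 - |s.1|)
  left_inv t := by
    have h : 0 < 1 + |t| := by have := abs_nonneg t; linarith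
    simp only
    rw [abs_div, abs_of_pos h]
    have h2 : 1 - |t| / (1 + |t|) = 1 / (1 + |t|) := by field_simp; ring
    rw [h2, div_div_div_cancel_right₀ h.ne', div_one]
  right_inv s := by
    obtain ⟨s, hs1, hs2⟩ := s
    have h : 0 < 1 - |s| := by rw [sub_pos, abs_lt]; exact ⟨hs1, hs2⟩
    apply Subtype.ext
    simp only
    rw [abs_div, abs_of_pos h]
    have h2 : 1 + |s| / (1 - |s|) = 1 / (1 - |s|) := by field_simp; ring
    rw [h2, div_div_div_cancel_right₀ h.ne', div_one]
  continuous_toFun := by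
    refine Continuous.subtype_mk (continuous_id.div (continuous_const.add continuous_abs)
      fun t ↦ ne_of_gt (show (0 : ℝ) < 1 + |t| by have := abs_nonneg t; linarith)) _
  continuous_invFun := by
    refine (continuous_subtype_val.div (continuous_const.sub
      (continuous_abs.comp continuous_subtype_val)) fun s ↦ ?_)
    have : |s.1| < 1 := abs_lt.2 s.2
    linarith

/-- `τ 0 = 0`. [folklore] -/
@[simp] theorem realToIoo_zero_val : (realToIoo 0).1 = 0 := by
  simp [realToIoo]

/-- The vector `(y, s)` with `‖y‖_∞ = 1`, `|s| < 1` lies on the cube sphere `Q_{j+1}`. [folklore] -/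
theorem snoc_mem_cubeSphere (y : CubeSphere j) (s : Ioo (-1 : ℝ) 1) :
    (Fin.snoc y.1 s.1 : RVec (j + 2)) ∈ sphere (0 : RVec (j + 2)) 1 := by
  have hs : |s.1| ≤ 1 := (abs_lt.2 s.2).le
  obtain ⟨i, hi⟩ := y.exists_abs_apply_eq_one
  refine mem_cubeSphere_of_abs_le (fun k ↦ ?_) (i₀ := Fin.castSucc i) (by simpa using hi)
  refine Fin.lastCases ?_ (fun k ↦ ?_) k
  · simpa using hs
  · simpa using y.abs_apply_le k

/-- The open subset `{|x_last| < 1}` of `Q_{j+1} × ℝᶜ`, a product neighbourhood of the equator.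
[folklore] -/
def equatorNhd (j c : ℕ) : Set (CubeSphere (j + 1) × RVec c) :=
  {p | |p.1.1 (Fin.last (j + 1))| < 1}

/-- The product neighbourhood of the equator is open. [folklore] -/
theorem isOpen_equatorNhd (j c : ℕ) : IsOpen (equatorNhd j c) :=
  isOpen_lt (continuous_abs.comp ((continuous_apply _).comp
    (continuous_subtype_val.comp continuous_fst))) continuous_const

/-- For `|x_last| < 1` the first coordinates of a point of `Q_{j+1}` form a point of `Q_j`.
[folklore] -/
theorem init_mem_cubeSphere {x : CubeSphere (j + 1)} (hx : |x.1 (Fin.last (j + 1))| < 1) :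
    (fun i : Fin (j + 1) ↦ x.1 (Fin.castSucc i)) ∈ sphere (0 : RVec (j + 1)) 1 := by
  obtain ⟨i, hi⟩ := x.exists_abs_apply_eq_one
  revert hi
  refine Fin.lastCases (fun hi ↦ ?_) (fun i hi ↦ ?_) i
  · exact absurd hi hx.ne
  · exact mem_cubeSphere_of_abs_le (fun k ↦ x.abs_apply_le _) (i₀ := i) hi

/-- **The equator tube**: the homeomorphism `Q_j × ℝᶜ⁺¹ ≃ₜ {|x_last| < 1} ⊆ Q_{j+1} × ℝᶜ`,
`(y, w) ↦ ((y, τ w₀), (w₁, …, w_c))`. [folklore] -/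
def equatorHomeomorph (j c : ℕ) : (CubeSphere j × RVec (c + 1)) ≃ₜ ↥(equatorNhd j c) where
  toFun p := ⟨(⟨Fin.snoc p.1.1 (realToIoo (p.2 0)).1, snoc_mem_cubeSphere p.1 _⟩, Fin.tail p.2),
    by
      show |(Fin.snoc p.1.1 (realToIoo (p.2 0)).1 : RVec (j + 2)) (Fin.last (j + 1))| < 1
      rw [Fin.snoc_last]
      exact abs_lt.2 (realToIoo (p.2 0)).2⟩
  invFun q := (⟨fun i ↦ q.1.1.1 (Fin.castSucc i), init_mem_cubeSphere q.2⟩,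
    Fin.cons (realToIoo.symm ⟨q.1.1.1 (Fin.last (j + 1)), abs_lt.1 q.2⟩) q.1.2)
  left_inv p := by
    obtain ⟨y, w⟩ := p
    simp only [Fin.snoc_castSucc, Fin.snoc_last, Subtype.coe_eta, Homeomorph.symm_apply_apply,
      Fin.cons_self_tail]
  right_inv q := by
    obtain ⟨⟨x, v⟩, hq⟩ := q
    apply Subtype.ext
    simp only [Fin.cons_zero, Homeomorph.apply_symm_apply, Fin.tail_cons, Prod.mk.injEq, and_true]
    apply Subtype.ext
    exact Fin.snoc_init_self x.1
  continuous_toFun := by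
    refine Continuous.subtype_mk (Continuous.prodMk ?_ ?_) _
    · refine Continuous.subtype_mk (continuous_pi fun i ↦ ?_) _
      refine Fin.lastCases ?_ (fun i ↦ ?_) i
      · simp only [Fin.snoc_last]
        exact continuous_subtype_val.comp (realToIoo.continuous.comp
          ((continuous_apply 0).comp continuous_snd))
      · simp only [Fin.snoc_castSucc]
        exact (continuous_apply _).comp (continuous_subtype_val.comp continuous_fst)
    · exact (continuous_pi fun i ↦ (continuous_apply _).comp continuous_snd)
  continuous_invFun := by
    refine Continuous.prodMk ?_ ?_
    · refine Continuous.subtype_mk (continuous_pi fun i ↦ ?_) _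
      exact (continuous_apply _).comp (continuous_subtype_val.comp
        (continuous_fst.comp continuous_subtype_val))
    · refine continuous_pi fun i ↦ ?_
      refine Fin.cases ?_ (fun i ↦ ?_) i
      · simp only [Fin.cons_zero]
        refine realToIoo.symm.continuous.comp (Continuous.subtype_mk ?_ _)
        exact (continuous_apply _).comp (continuous_subtype_val.comp
          (continuous_fst.comp continuous_subtype_val))
      · simp only [Fin.cons_succ]
        exact (continuous_apply _).comp (continuous_snd.comp continuous_subtype_val)

/-- **The equator tube** `Q_j × ℝᶜ⁺¹ → Q_{j+1} × ℝᶜ`, `(y, w) ↦ ((y, τ w₀), (w₁, …, w_c))`, an open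
embedding onto `{|x_last| < 1}`. [folklore] -/
def equatorEmb (j c : ℕ) (p : CubeSphere j × RVec (c + 1)) : CubeSphere (j + 1) × RVec c :=
  (equatorHomeomorph j c p).1

/-- The equator tube is an open embedding. [folklore] -/
theorem isOpenEmbedding_equatorEmb (j c : ℕ) : IsOpenEmbedding (equatorEmb j c) :=
  ((isOpen_equatorNhd j c).isOpenEmbedding_subtypeVal).comp (equatorHomeomorph j c).isOpenEmbedding

/-- **The core of the equator tube is the equator**:
`equatorEmb (Q_j × 0) = equator × 0`. [folklore] -/
theorem image_equatorEmb_core (j c : ℕ) :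
    equatorEmb j c '' (univ ×ˢ {0}) = equator j ×ˢ ({0} : Set (RVec c)) := by
  ext ⟨x, v⟩
  constructor
  · rintro ⟨⟨y, w⟩, ⟨-, hw⟩, h⟩
    rw [mem_singleton_iff] at hw
    subst hw
    have h1 : (equatorEmb j c (y, 0)).1 = x := congrArg Prod.fst h
    have h2 : (equatorEmb j c (y, 0)).2 = v := congrArg Prod.snd h
    refine ⟨?_, ?_⟩
    · show x.1 (Fin.last (j + 1)) = 0
      rw [← h1]
      show (Fin.snoc y.1 (realToIoo ((0 : RVec (c + 1)) 0)).1 : RVec (j + 2)) (Fin.last (j + 1)) = 0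
      rw [Fin.snoc_last, Pi.zero_apply, realToIoo_zero_val]
    · rw [mem_singleton_iff, ← h2]
      rfl
  · rintro ⟨hx, hv⟩
    rw [mem_singleton_iff] at hv
    subst hv
    have hx0 : x.1 (Fin.last (j + 1)) = 0 := hx
    have hx1 : |x.1 (Fin.last (j + 1))| < 1 := by rw [hx0, abs_zero]; exact one_pos
    refine ⟨(⟨_, init_mem_cubeSphere hx1⟩, 0), ⟨mem_univ _, rfl⟩, ?_⟩
    apply Prod.ext
    · apply Subtype.ext
      show (Fin.snoc (fun i : Fin (j + 1) ↦ x.1 (Fin.castSucc i))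
        (realToIoo ((0 : RVec (c + 1)) 0)).1 : RVec (j + 2)) = x.1
      rw [Pi.zero_apply, realToIoo_zero_val, ← hx0]
      exact Fin.snoc_init_self x.1
    · rfl

end CubeModel

/-! ### The two points of `Q₀` and the Euclidean model of the sphere -/

section PointsAndEuclid

/-- The point `+1` of `Q₀ = {±1}`. [folklore] -/
def cubeSpherePos : CubeSphere 0 := ⟨fun _ ↦ 1, by simp⟩

/-- The point `-1` of `Q₀ = {±1}`. [folklore] -/
def cubeSphereNeg : CubeSphere 0 := ⟨fun _ ↦ -1, by simp⟩

/-- `Q₀ = {+1, -1}`. [folklore] -/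
theorem eq_cubeSpherePos_or_eq_cubeSphereNeg (x : CubeSphere 0) :
    x = cubeSpherePos ∨ x = cubeSphereNeg := by
  obtain ⟨i, hi⟩ := x.exists_abs_apply_eq_one
  have hi0 : i = 0 := Fin.eq_zero i
  subst hi0
  rcases (abs_eq zero_le_one).1 hi with h | h
  · left
    apply Subtype.ext; funext k
    have hk : k = 0 := Fin.eq_zero k
    subst hk
    rw [h]; rfl
  · right
    apply Subtype.ext; funext k
    have hk : k = 0 := Fin.eq_zero k
    subst hk
    rw [h]; rfl

/-- `+1 ≠ -1` in `Q₀`. [folklore] -/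
theorem cubeSpherePos_ne_cubeSphereNeg : cubeSpherePos ≠ cubeSphereNeg := by
  intro h
  have := congrArg (fun x : CubeSphere 0 ↦ x.1 0) h
  change (1 : ℝ) = -1 at this
  norm_num at this

/-- Singletons of `Q₀` are open (`Q₀` is discrete). [folklore] -/
theorem isOpen_singleton_cubeSphere_zero (e : CubeSphere 0) :
    IsOpen ({e} : Set (CubeSphere 0)) := by
  have h : ({e} : Set (CubeSphere 0)) = (fun x : CubeSphere 0 ↦ e.1 0 * x.1 0) ⁻¹' Ioi 0 := by
    ext x
    simp only [mem_singleton_iff, mem_preimage, mem_Ioi]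
    have he : e.1 0 = 1 ∨ e.1 0 = -1 := by
      rcases eq_cubeSpherePos_or_eq_cubeSphereNeg e with rfl | rfl
      · exact Or.inl rfl
      · exact Or.inr rfl
    have hx : x.1 0 = 1 ∨ x.1 0 = -1 := by
      rcases eq_cubeSpherePos_or_eq_cubeSphereNeg x with rfl | rfl
      · exact Or.inl rfl
      · exact Or.inr rfl
    constructor
    · rintro rfl
      rcases he with h | h <;> rw [h] <;> norm_num
    · intro hpos
      apply Subtype.ext; funext k
      have hk : k = 0 := Fin.eq_zero k
      subst hk
      rcases he with h | h <;> rcases hx with h' | h' <;> rw [h, h'] at hpos ⊢ <;> norm_num at hpos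
  rw [h]
  exact isOpen_Ioi.preimage
    (continuous_const.mul ((continuous_apply 0).comp continuous_subtype_val))

/-- For `e ∈ Q₀` the slice `v ↦ (e, v)` is an open embedding `ℝᶜ → Q₀ × ℝᶜ`. [folklore] -/
theorem isOpenEmbedding_prodMk_cubeSphere_zero (e : CubeSphere 0) (c : ℕ) :
    IsOpenEmbedding (Prod.mk e : RVec c → CubeSphere 0 × RVec c) := by
  refine ⟨isEmbedding_prodMkRight e, ?_⟩
  have h : range (Prod.mk e : RVec c → CubeSphere 0 × RVec c) = {e} ×ˢ univ := by
    ext ⟨a, v⟩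
    simp [eq_comm]
  rw [h]
  exact (isOpen_singleton_cubeSphere_zero e).prod isOpen_univ

/-- Radial normalisation `z ↦ z / ‖z‖` in a real normed space is unchanged by positive rescaling.
[folklore] -/
theorem inv_norm_smul_smul {F : Type*} [NormedAddCommGroup F] [NormedSpace ℝ F] {t : ℝ}
    (ht : 0 < t) (z : F) : ‖t • z‖⁻¹ • (t • z) = ‖z‖⁻¹ • z := by
  rw [norm_smul, Real.norm_eq_abs, abs_of_pos ht, smul_smul]
  by_cases hz : z = 0
  · simp [hz]
  · congr 1
    field_simp

/-- The Euclidean vector underlying a point of the cube sphere is nonzero. [folklore] -/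
theorem toLp_cubeSphere_ne_zero {k : ℕ} (x : CubeSphere k) :
    (WithLp.toLp 2 x.1 : EuclideanSpace ℝ (Fin (k + 1))) ≠ 0 := by
  intro h
  rw [WithLp.toLp_eq_zero] at h
  have := mem_sphere_zero_iff_norm.1 x.2
  rw [h, norm_zero] at this
  exact zero_ne_one this

/-- The sup-norm vector underlying a point of the Euclidean unit sphere is nonzero. [folklore] -/
theorem ofLp_sphere_ne_zero {k : ℕ} (y : sphere (0 : EuclideanSpace ℝ (Fin (k + 1))) 1) :
    WithLp.ofLp y.1 ≠ 0 := by
  intro h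
  rw [WithLp.ofLp_eq_zero] at h
  have := mem_sphere_zero_iff_norm.1 y.2
  rw [h, norm_zero] at this
  exact zero_ne_one this

/-- **The radial homeomorphism `Q_k ≃ₜ 𝕊ᵏ`** between the cube model and the Euclidean unit
sphere, `x ↦ x / ‖x‖₂`, `y ↦ y / ‖y‖_∞`. [folklore] -/
def sphereSupHomeomorph (k : ℕ) :
    CubeSphere k ≃ₜ sphere (0 : EuclideanSpace ℝ (Fin (k + 1))) 1 where
  toFun x := ⟨‖(WithLp.toLp 2 x.1 : EuclideanSpace ℝ (Fin (k + 1)))‖⁻¹ •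
      (WithLp.toLp 2 x.1 : EuclideanSpace ℝ (Fin (k + 1))), by
    rw [mem_sphere_zero_iff_norm, norm_smul, norm_inv, norm_norm,
      inv_mul_cancel₀ (norm_ne_zero_iff.2 (toLp_cubeSphere_ne_zero x))]⟩
  invFun y := ⟨‖WithLp.ofLp y.1‖⁻¹ • WithLp.ofLp y.1, by
    rw [mem_sphere_zero_iff_norm, norm_smul, norm_inv, norm_norm,
      inv_mul_cancel₀ (norm_ne_zero_iff.2 (ofLp_sphere_ne_zero y))]⟩
  left_inv x := by
    apply Subtype.ext
    have hx : ‖x.1‖ = 1 := mem_sphere_zero_iff_norm.1 x.2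
    have hr : 0 < ‖(WithLp.toLp 2 x.1 : EuclideanSpace ℝ (Fin (k + 1)))‖⁻¹ :=
      inv_pos.2 (norm_pos_iff.2 (toLp_cubeSphere_ne_zero x))
    simp only [WithLp.ofLp_smul]
    rw [inv_norm_smul_smul hr, hx, inv_one, one_smul]
  right_inv y := by
    apply Subtype.ext
    have hy : ‖y.1‖ = 1 := mem_sphere_zero_iff_norm.1 y.2
    have hr : 0 < ‖WithLp.ofLp y.1‖⁻¹ := inv_pos.2 (norm_pos_iff.2 (ofLp_sphere_ne_zero y))
    simp only [WithLp.toLp_smul, WithLp.toLp_ofLp]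
    rw [inv_norm_smul_smul hr, hy, inv_one, one_smul]
  continuous_toFun := by
    refine Continuous.subtype_mk ?_ _
    have hc : Continuous fun x : CubeSphere k ↦
        (WithLp.toLp 2 x.1 : EuclideanSpace ℝ (Fin (k + 1))) :=
      (PiLp.continuous_toLp 2 _).comp continuous_subtype_val
    exact (hc.norm.inv₀ fun x ↦ norm_ne_zero_iff.2 (toLp_cubeSphere_ne_zero x)).smul hc
  continuous_invFun := by
    refine Continuous.subtype_mk ?_ _
    have hc : Continuous fun y : sphere (0 : EuclideanSpace ℝ (Fin (k + 1))) 1 ↦ WithLp.ofLp y.1 :=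
      (PiLp.continuous_ofLp 2 _).comp continuous_subtype_val
    exact (hc.norm.inv₀ fun y ↦ norm_ne_zero_iff.2 (ofLp_sphere_ne_zero y)).smul hc

end PointsAndEuclid

/-! ### Vanishing of the local homology along the core -/

section Core

variable {X : Type u} [TopologicalSpace X] [T2Space X]

/-- The image of a closed piece of the core is closed. [folklore] -/
theorem isClosed_image_prod_zero {j c : ℕ} {ψ : CubeSphere j × RVec c → X} (hψ : Continuous ψ)
    {A : Set (CubeSphere j)} (hA : IsClosed A) : IsClosed (ψ '' (A ×ˢ ({0} : Set (RVec c)))) :=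
  ((hA.isCompact.prod isCompact_singleton).image hψ).isClosed

/-- **`H_i(X | ψ(A × 0)) = 0`, `i ≠ j + 1 + c`, for the upper half `A` of `Q_{j+1}`**: along the
open embedding `(y, v) ↦ ψ(P⁻¹ y, v)` of `ℝʲ⁺¹ × ℝᶜ` the piece `ψ(A × 0)` is the image of the
convex compactum `[-2, 2]ʲ⁺¹ × 0`. [cite: HatcherAT2002, Lemma 3.27] -/
theorem isZero_localHomologyOfSet_image_upperHalf {j c : ℕ} {ψ : CubeSphere (j + 1) × RVec c → X}
    (hψ : IsOpenEmbedding ψ) {i : ℕ} (hi : i ≠ j + 1 + c) :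
    IsZero (localHomologyOfSet R M X (ψ '' (upperHalf j ×ˢ {0})) i) := by
  have hκ : IsOpenEmbedding (ψ ∘ Prod.map cubeProjInv (id : RVec c → RVec c)) :=
    hψ.comp (isOpenEmbedding_cubeProjInv.prodMap IsOpenEmbedding.id)
  have himage : (ψ ∘ Prod.map cubeProjInv (id : RVec c → RVec c)) ''
      (closedBall (0 : RVec (j + 1)) 2 ×ˢ {0}) = ψ '' (upperHalf j ×ˢ {0}) := by
    rw [image_comp, prodMap_image_prod, image_cubeProjInv_closedBall, image_id]
  have hclosed : IsClosed ((ψ ∘ Prod.map cubeProjInv (id : RVec c → RVec c)) ''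
      (closedBall (0 : RVec (j + 1)) 2 ×ˢ {0})) := by
    rw [himage]; exact isClosed_image_prod_zero hψ.continuous isClosed_upperHalf
  rw [← himage, ← localHomologyOfSet.isZero_iff_of_isOpenEmbedding R M hκ hclosed]
  have hne : (closedBall (0 : RVec (j + 1)) 2 ×ˢ ({0} : Set (RVec c))).Nonempty :=
    ⟨(0, 0), mem_prod.2 ⟨mem_closedBall_self (by norm_num), mem_singleton 0⟩⟩
  have hconv : Convex ℝ (closedBall (0 : RVec (j + 1)) 2 ×ˢ ({0} : Set (RVec c))) :=
    (convex_closedBall _ _).prod (convex_singleton 0)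
  have hcpt : IsCompact (closedBall (0 : RVec (j + 1)) 2 ×ˢ ({0} : Set (RVec c))) :=
    (isCompact_closedBall _ _).prod isCompact_singleton
  have hi' : i ≠ (j + 1) + c := hi
  exact isZero_localHomologyOfSet_rvec_prod_of_convex R M (a := j + 1) (b := c) hconv hcpt hne hi' 

/-- **`H_i(X | ψ(B × 0)) = 0`, `i ≠ j + 1 + c`, for the lower half `B` of `Q_{j+1}`** (the upper
half of the reflected tube `ψ ∘ (negLast × id)`). [cite: HatcherAT2002, Lemma 3.27] -/
theorem isZero_localHomologyOfSet_image_lowerHalf {j c : ℕ} {ψ : CubeSphere (j + 1) × RVec c → X}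
    (hψ : IsOpenEmbedding ψ) {i : ℕ} (hi : i ≠ j + 1 + c) :
    IsZero (localHomologyOfSet R M X (ψ '' (lowerHalf j ×ˢ {0})) i) := by
  have h := isZero_localHomologyOfSet_image_upperHalf R M
    (hψ.comp (negLast.isOpenEmbedding.prodMap IsOpenEmbedding.id)) (c := c) hi
  rwa [image_comp, prodMap_image_prod, image_negLast_upperHalf, image_id] at h

omit [T2Space X] in
/-- `H_n(X | ∅) = 0` (private copy of the tree's `isZero_localHomologyOfSet_empty` of
`BoundaryComplementHomology.lean`, to keep the import closure small). [folklore] -/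
private theorem isZero_localHomologyOfSet_empty' (n : ℕ) :
    IsZero (localHomologyOfSet R M X (∅ : Set X) n) := by
  show IsZero (relativeSingularHomology R M X (∅ : Set X)ᶜ n)
  rw [Set.compl_empty]
  exact isZero_relativeSingularHomology_univ R M n

/-- `H_i(X | ψ(e, 0)) = 0` for `i ≠ c` and a point `e` of `Q₀` (along the slice `v ↦ ψ(e, v)`,
`H_i(X | pt) ≅ H_i(ℝᶜ | 0)`). [cite: HatcherAT2002, §3.3 p. 231] -/
theorem isZero_localHomologyOfSet_point {c : ℕ} {ψ : CubeSphere 0 × RVec c → X}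
    (hψ : IsOpenEmbedding ψ) (e : CubeSphere 0) {i : ℕ} (hi : i ≠ c) :
    IsZero (localHomologyOfSet R M X {ψ (e, 0)} i) := by
  have hκ : IsOpenEmbedding (ψ ∘ Prod.mk e) := hψ.comp (isOpenEmbedding_prodMk_cubeSphere_zero e c)
  have himage : (ψ ∘ Prod.mk e) '' {0} = {ψ (e, 0)} := by rw [image_singleton]; rfl
  have hclosed : IsClosed ((ψ ∘ Prod.mk e) '' {0}) := by rw [himage]; exact isClosed_singleton
  rw [← himage, ← localHomologyOfSet.isZero_iff_of_isOpenEmbedding R M hκ hclosed]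
  exact isZero_localHomology_rvec R M 0 hi

omit [TopologicalSpace X] [T2Space X] in
/-- The core of `ψ : Q₀ × ℝᶜ → X` consists of the two points `ψ(±1, 0)`. [folklore] -/
theorem image_core_zero {c : ℕ} (ψ : CubeSphere 0 × RVec c → X) :
    ψ '' (univ ×ˢ {0}) = {ψ (cubeSpherePos, 0)} ∪ {ψ (cubeSphereNeg, 0)} := by
  ext p
  simp only [mem_image, mem_prod, mem_univ, true_and, mem_singleton_iff, Prod.exists, mem_union]
  constructor
  · rintro ⟨x, v, rfl, rfl⟩
    rcases eq_cubeSpherePos_or_eq_cubeSphereNeg x with rfl | rfl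
    · exact Or.inl rfl
    · exact Or.inr rfl
  · rintro (rfl | rfl)
    · exact ⟨_, 0, rfl, rfl⟩
    · exact ⟨_, 0, rfl, rfl⟩

/-- **Vanishing of the local homology along the core of a cube-sphere tube**: for an open
embedding `ψ : Q_j × ℝᶜ → X` into a Hausdorff space, `H_i(X | ψ(Q_j × 0); M) = 0` for all `i < c`
(induction on `j` over flat hemispheres, see the module docstring; Kosinski 1993, X.1, proof of
Prop. (1.1); Hatcher 2002, relative Mayer–Vietoris, §2.2 p. 152).
[cite: Kosinski1993, Ch. X §1, Prop. 1.1] -/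
theorem isZero_localHomologyOfSet_cubeSphereCore (j : ℕ) :
    ∀ (c : ℕ) (ψ : CubeSphere j × RVec c → X) (_ : IsOpenEmbedding ψ) {i : ℕ} (_ : i < c),
      IsZero (localHomologyOfSet R M X (ψ '' (univ ×ˢ {0})) i) := by
  induction j with
  | zero =>
    intro c ψ hψ i hi
    rw [image_core_zero]
    have hne : ψ (cubeSpherePos, 0) ≠ ψ (cubeSphereNeg, 0) := fun h ↦
      cubeSpherePos_ne_cubeSphereNeg (congrArg Prod.fst (hψ.injective h))
    refine localHomologyOfSet.isZero_localHomologyOfSet_union R M isClosed_singleton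
      isClosed_singleton i
      (isZero_localHomologyOfSet_point R M hψ _ hi.ne)
      (isZero_localHomologyOfSet_point R M hψ _ hi.ne) fun y ↦ ⟨0, ?_⟩
    have hz : IsZero (localHomologyOfSet R M X
        (({ψ (cubeSpherePos, 0)} : Set X) ∩ {ψ (cubeSphereNeg, 0)}) (i + 1)) := by
      have he : (({ψ (cubeSpherePos, 0)} : Set X) ∩ {ψ (cubeSphereNeg, 0)}) = ∅ :=
        singleton_inter_eq_empty.2 hne
      rw [he]
      exact isZero_localHomologyOfSet_empty' R M (i + 1)
    haveI := ModuleCat.subsingleton_of_isZero hz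
    exact Subsingleton.elim _ _
  | succ j ih =>
    intro c ψ hψ i hi
    -- the two halves and their intersection, the equator
    have hcore : ψ '' (univ ×ˢ {0}) = ψ '' (upperHalf j ×ˢ {0}) ∪ ψ '' (lowerHalf j ×ˢ {0}) := by
      rw [← image_union, ← union_prod, upperHalf_union_lowerHalf]
    have hinter : ψ '' (upperHalf j ×ˢ {0}) ∩ ψ '' (lowerHalf j ×ˢ {0}) =
        (ψ ∘ equatorEmb j c) '' (univ ×ˢ {0}) := by
      rw [← image_inter hψ.injective, image_comp, image_equatorEmb_core,
        ← upperHalf_inter_lowerHalf, inter_prod]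
    -- induction hypothesis along the equator tube, fibre dimension `c + 1`
    have hIH : IsZero (localHomologyOfSet R M X
        (ψ '' (upperHalf j ×ˢ {0}) ∩ ψ '' (lowerHalf j ×ˢ {0})) (i + 1)) := by
      rw [hinter]
      exact ih (c + 1) (ψ ∘ equatorEmb j c) (hψ.comp (isOpenEmbedding_equatorEmb j c))
        (by omega)
    rw [hcore]
    refine localHomologyOfSet.isZero_localHomologyOfSet_union R M
      (isClosed_image_prod_zero hψ.continuous isClosed_upperHalf)
      (isClosed_image_prod_zero hψ.continuous isClosed_lowerHalf) i
      (isZero_localHomologyOfSet_image_upperHalf R M hψ (by omega))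
      (isZero_localHomologyOfSet_image_lowerHalf R M hψ (by omega)) fun y ↦
        ⟨0, by haveI := ModuleCat.subsingleton_of_isZero hIH; exact Subsingleton.elim _ _⟩

/-- **Vanishing of the local homology along the core of a tube `𝕊ᵏ × ℝᶜ ↪ X`** (Euclidean unit
sphere and Euclidean fibre, as for the tree's framed sphere families): for an open embedding
`φ : 𝕊ᵏ × ℝᶜ → X` into a Hausdorff space and `Σ = φ(𝕊ᵏ × 0)`,
`H_i(X | Σ; M) = H_i(X, X ∖ Σ; M) = 0` for all `i < c` (Kosinski 1993, X.1, proof of Prop. (1.1):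
removing a sphere of codimension `c` does not affect homology below degree `c - 1`).
[cite: Kosinski1993, Ch. X §1, Prop. 1.1] -/
theorem isZero_localHomologyOfSet_sphereCore {k c : ℕ}
    {φ : sphere (0 : EuclideanSpace ℝ (Fin (k + 1))) 1 × EuclideanSpace ℝ (Fin c) → X}
    (hφ : IsOpenEmbedding φ) {i : ℕ} (hi : i < c) :
    IsZero (localHomologyOfSet R M X (φ '' (univ ×ˢ {0})) i) := by
  let g : RVec c ≃ₜ EuclideanSpace ℝ (Fin c) := (EuclideanSpace.equiv (Fin c) ℝ).symm.toHomeomorph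
  have hψ : IsOpenEmbedding (φ ∘ Prod.map (sphereSupHomeomorph k) g) :=
    hφ.comp ((sphereSupHomeomorph k).isOpenEmbedding.prodMap g.isOpenEmbedding)
  have h := isZero_localHomologyOfSet_cubeSphereCore R M k c _ hψ hi
  have hg : g '' {0} = {0} := by
    rw [image_singleton]
    exact congrArg _ (map_zero (EuclideanSpace.equiv (Fin c) ℝ).symm)
  rwa [image_comp, prodMap_image_prod, image_univ_of_surjective (sphereSupHomeomorph k).surjective,
    hg] at h

end Core

/-! ### Consequences for the homology of the complement (long exact sequence of the pair) -/

section Complement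

variable {X : Type u} [TopologicalSpace X]

/-- **`H_i(X ∖ S) → H_i(X)` is injective when `H_{i+1}(X | S) = 0`** (exactness of
`H_{i+1}(X, X ∖ S) →∂ H_i(X ∖ S) → H_i(X)`, Hatcher 2002, Thm. 2.13 ff.).
[cite: HatcherAT2002, Thm. 2.16] -/
theorem mono_map_subsetIncl_compl_of_isZero {S : Set X} {i : ℕ}
    (h1 : IsZero (localHomologyOfSet R M X S (i + 1))) :
    Mono (singularHomology.map R M (subsetIncl Sᶜ) i) :=
  (relativeSingularHomology.exact_δ_map R M Sᶜ i).mono_g (h1.eq_of_src _ _)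

/-- **`H_i(X ∖ S) → H_i(X)` is surjective when `H_i(X | S) = 0`** (exactness of
`H_i(X ∖ S) → H_i(X) → H_i(X, X ∖ S)`). [cite: HatcherAT2002, Thm. 2.16] -/
theorem epi_map_subsetIncl_compl_of_isZero {S : Set X} {i : ℕ}
    (h0 : IsZero (localHomologyOfSet R M X S i)) :
    Epi (singularHomology.map R M (subsetIncl Sᶜ) i) :=
  (relativeSingularHomology.exact_map_ofAbsolute R M Sᶜ i).epi_f (h0.eq_of_tgt _ _)

/-- **`H_i(X ∖ S) ≅ H_i(X)` when `H_i(X | S) = H_{i+1}(X | S) = 0`** (long exact sequence of the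
pair `(X, X ∖ S)`, Hatcher 2002, Thm. 2.13 ff.). [cite: HatcherAT2002, Thm. 2.16] -/
theorem isIso_map_subsetIncl_compl_of_isZero {S : Set X} {i : ℕ}
    (h0 : IsZero (localHomologyOfSet R M X S i))
    (h1 : IsZero (localHomologyOfSet R M X S (i + 1))) :
    IsIso (singularHomology.map R M (subsetIncl Sᶜ) i) :=
  haveI := mono_map_subsetIncl_compl_of_isZero R M h1
  haveI := epi_map_subsetIncl_compl_of_isZero R M h0
  isIso_of_mono_of_epi _

variable [T2Space X]

/-- **Removing a sphere of codimension `c` does not change `H_i` for `i + 1 < c`**: for an open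
embedding `φ : 𝕊ᵏ × ℝᶜ → X` into a Hausdorff space with core `Σ = φ(𝕊ᵏ × 0)`, the inclusion
`X ∖ Σ ↪ X` induces isomorphisms `H_i(X ∖ Σ; M) ≅ H_i(X; M)` for `i + 1 < c` (Kosinski 1993, X.1,
Prop. (1.1), proof: "`H_i(M ∖ S) → H_i M` is an isomorphism for `i < m - k`" — here without
general position). [cite: Kosinski1993, Ch. X §1, Prop. 1.1] -/
theorem isIso_map_subsetIncl_compl_sphereCore {k c : ℕ}
    {φ : sphere (0 : EuclideanSpace ℝ (Fin (k + 1))) 1 × EuclideanSpace ℝ (Fin c) → X}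
    (hφ : IsOpenEmbedding φ) {i : ℕ} (hi : i + 1 < c) :
    IsIso (singularHomology.map R M (subsetIncl (φ '' (univ ×ˢ {0}))ᶜ) i) :=
  isIso_map_subsetIncl_compl_of_isZero R M (isZero_localHomologyOfSet_sphereCore R M hφ (by omega))
    (isZero_localHomologyOfSet_sphereCore R M hφ hi)

/-- **Removing a sphere of codimension `c` keeps `H_i(X ∖ Σ) → H_i(X)` surjective for `i < c`.**
[cite: Kosinski1993, Ch. X §1, Prop. 1.1] -/
theorem epi_map_subsetIncl_compl_sphereCore {k c : ℕ}
    {φ : sphere (0 : EuclideanSpace ℝ (Fin (k + 1))) 1 × EuclideanSpace ℝ (Fin c) → X}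
    (hφ : IsOpenEmbedding φ) {i : ℕ} (hi : i < c) :
    Epi (singularHomology.map R M (subsetIncl (φ '' (univ ×ˢ {0}))ᶜ) i) :=
  epi_map_subsetIncl_compl_of_isZero R M (isZero_localHomologyOfSet_sphereCore R M hφ hi)

end Complement

end Literature.AlgebraicTopology.SingularHomology
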